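import Summits.ValiantsHypothesis.ValiantsHypothesis.Theorems.KPlusLogSqLawTropicalBNewtonPolygon

/-!
# Route «KPlusLogSqLaw», crux `TropicalB` (stmt-ValiantsHypothesis-19771) — CHORD SLACK and the PAIR-INTERACTION LAW:
# quantitative convexity of the Newton polygon of a dominant chain (all chords, all squares, all shifted windows)

HONEST FRAMING.  Helper file (cell `pub-symmetroid`, seat val-sym-trop-p1 g32, 2026-08-29; Newton-polygon docket of the lineage)
`--supports` the crux `Summit.ValiantsHypothesis.ValiantsHypothesis.Theses.KPlusLogSqLaw.TropicalB` (item `stmt-ValiantsHypothesis-19771`,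
registered stubs `stub_tropThin` / `stub_tropFat` of `Cruxes/TropicalB/Lines/birth.lean`).  Elementary INEQUALITIES valid for every
sandwiched lattice chain — hence (by `NewtonPolygon.sandwich`) for every chain of unique optima of every dominance design of every format,
whatever the exponents, valuations and support.  Def-free.  Nothing here bounds `TropicalB` in its window and nothing bears on `WeakLifting`,
DoorA26 / DoorA34, `MatrixDescartes` (stmt-ValiantsHypothesis-18050) or VP ≠ VNP.

SETTING (as in `…TropicalBLatticeChain`, val-sym-trop-p1 g2).  An abstract chain `(Θ, S, C) : ℕ → ℤ` on `[0, n]` with `Θ i < Θ (i+1)` and the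
SANDWICH `Θ i · ΔSᵢ < ΔCᵢ < Θ (i+1) · ΔSᵢ` at every step (`ΔSᵢ = S (i+1) − S i`, `ΔCᵢ = C (i+1) − C i`).  Along a dominant chain of a
design, `Θ` = the integer slopes, `S i` = total exponent `Σ_b d (λᵢ b)` and `C i` = valuation sum `Σ_b v (σᵢ b) b (λᵢ b)` of the `i`-th
term satisfy this (`NewtonPolygon.sandwich`); all three are integers, which is where the constants `1`, `2` below come from.

CONTENT (namespace `ChordSlack`; §1–§3 for the abstract chain, §4 = `ChordSlack.Design.*` for `ℕ`-indexed chains of unique optima).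
* §1 `theta_add_le`, `abscissa_add_le`, `step_area` (**`ΔΘᵢ·ΔSᵢ ≥ 2`**), the CHORD LAW `lt_chord` / `chord_lt` (`Θ i·(S j − S i) < C j − C i <
  Θ j·(S j − S i)`, `i < j`) and the **CHORD-SLACK LAW** `chord_slack_lower` / `chord_slack_upper`: `2(C j − C i) ≥ 2·Θ i·(S j − S i) + (j−i)(j−i+1)`
  and `2(C j − C i) ≤ 2·Θ j·(S j − S i) − (j−i)(j−i+1)` — a chord over `j − i` steps clears its end supporting lines by a TRIANGULAR NUMBER.
* §2 `square_law`: for `a < b ≤ c < e`, widths `W₁ = S b − S a`, `W₂ = S e − S c`: `(C e − C c)·W₁ − (C b − C a)·W₂ ≥ W₁W₂(Θ c − Θ b) + W₁ + W₂`;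
  **`interaction_law`** (equal widths `W`): `(C e − C c) − (C b − C a) ≥ W·(Θ c − Θ b) + 2 ≥ 2`; `not_modular_square`: `C a + C e ≠ C b + C c`.
* §3 `window_interaction`: if the `A` steps after `a` and after `a + B` (`B ≥ 1`) have the same abscissa increments then
  `(C (a+B+A) − C (a+B)) − (C (a+A) − C a) ≥ 2A + (B − 1)(S (a+A) − S a)`; `unit_window_interaction`: `≥ 2AB` on a UNIT-STEP chain
  (`ΔSᵢ = 1`), where slopes and ordinate increments each advance by `≥ 2` per step and interlace (`unit_theta_step`, `unit_increment_step`).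

READING (binary counters / radix-2 odometers: …TropicalBBinaryCounters, …TropicalBMarkedEdgeCounter, …TropicalBTransferLaw §3; no claim beyond
the theorems).  In a chain visiting the subsets of `L` special classes in binary order the patterns `w, w+2^u, w+2^v, w+2^u+2^v` (`u < v`, bits
`u, v` of `w` clear) sit at indices `a, a+A, a+B, a+A+B` with `A = 2^u`, `B = 2^v`, and the `A` steps after `a` and after `a+B` flip the same low
bits, so §3 applies: the VALUATION INTERACTION of bits `u < v` is `≥ 2^(u+1) + (2^v − 1)·d_u` in EVERY context (`≥ 2^(u+v+1)` for unit steps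
`d_l = 2^l`); no context admits two bits whose incidences are exchanged independently (a valuation-modular square: bit-separable, block or
fixed-cell ownership architectures).  Located companion (this seat, HOME/val-sym-trop-p1/g32/): two-mode «row-ownership» designs realise at
most 7 of the 8 patterns of a 3-bit counter on 3 nodes (local search), provably never 8 when the off-mode is an idle home cell.
[this seat; the sandwich / Newton-polygon reading is folklore (Jarník), the pairwise exchange behind §2 is the cell's …TropicalCycleMonotone]
-/

set_option linter.dupNamespace false
set_option autoImplicit false

namespace Summit.ValiantsHypothesis.ValiantsHypothesis.Theorems.KPlusLogSqLaw

open Summit.ValiantsHypothesis.ValiantsHypothesis.Theorems.MatrixDescartes.Negative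
open Finset

namespace ChordSlack

/-! ## §1 Steps and chords of a sandwiched lattice chain -/

section Lattice

variable {n : ℕ} {Θ S C : ℕ → ℤ}
  (hΘ : ∀ i, i < n → Θ i < Θ (i + 1))
  (hsw : ∀ i, i < n → Θ i * (S (i + 1) - S i) < C (i + 1) - C i ∧ C (i + 1) - C i < Θ (i + 1) * (S (i + 1) - S i))
include hΘ

/-- slopes advance by at least one per step: `Θ i + (j − i) ≤ Θ j` on `[0, n]`. [folklore] -/
theorem theta_add_le {i j : ℕ} (hij : i ≤ j) (hj : j ≤ n) : Θ i + ((j : ℤ) - i) ≤ Θ j := by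
  induction j, hij using Nat.le_induction with
  | base => simp
  | succ j hij ih =>
      have h1 := ih (by omega)
      have h2 := hΘ j (by omega)
      push_cast at h1 ⊢
      linarith

include hsw

/-- abscissae advance by at least one per step: `S i + (j − i) ≤ S j` on `[0, n]`. [folklore] -/
theorem abscissa_add_le {i j : ℕ} (hij : i ≤ j) (hj : j ≤ n) : S i + ((j : ℤ) - i) ≤ S j := by
  induction j, hij using Nat.le_induction with
  | base => simp
  | succ j hij ih =>
      have h1 := ih (by omega)
      have h2 := NewtonPolygon.step_pos hΘ hsw (i := j) (by omega)
      push_cast at h1 ⊢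
      linarith

omit hΘ in
/-- **step area**: `(Θ (i+1) − Θ i)·(S (i+1) − S i) ≥ 2` — the integer `ΔCᵢ` lies strictly between `Θ i·ΔSᵢ` and `Θ (i+1)·ΔSᵢ`.
[folklore] -/
theorem step_area {i : ℕ} (hi : i < n) : 2 ≤ (Θ (i + 1) - Θ i) * (S (i + 1) - S i) := by
  obtain ⟨h1, h2⟩ := hsw i hi
  have h3 : Θ i * (S (i + 1) - S i) + 1 ≤ C (i + 1) - C i := h1
  have h4 : C (i + 1) - C i + 1 ≤ Θ (i + 1) * (S (i + 1) - S i) := h2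
  nlinarith

/-- **chord law, lower half**: `Θ i·(S j − S i) < C j − C i` for `i < j ≤ n` (with slack `j − i`). [folklore] -/
theorem lt_chord_add {i j : ℕ} (hij : i < j) (hj : j ≤ n) : Θ i * (S j - S i) + ((j : ℤ) - i) ≤ C j - C i := by
  induction j, hij using Nat.le_induction with
  | base =>
      have h1 := (hsw i (by omega)).1
      push_cast
      linarith
  | succ j hij ih =>
      have h1 := ih (by omega)
      have h2 := (hsw j (by omega)).1
      have h3 : Θ i ≤ Θ j := NewtonPolygon.mono_of_succ_lt hΘ (by omega) (by omega)
      have h4 := NewtonPolygon.step_pos hΘ hsw (i := j) (by omega)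
      have h5 : Θ i * (S (j + 1) - S j) ≤ Θ j * (S (j + 1) - S j) := mul_le_mul_of_nonneg_right h3 (by linarith)
      push_cast at h1 ⊢
      nlinarith

/-- **chord law, lower half**: `Θ i·(S j − S i) < C j − C i` for `i < j ≤ n`. [folklore] -/
theorem lt_chord {i j : ℕ} (hij : i < j) (hj : j ≤ n) : Θ i * (S j - S i) < C j - C i := by
  have h := lt_chord_add hΘ hsw hij hj
  have : (0 : ℤ) < (j : ℤ) - i := by
    have : (i : ℤ) < j := by exact_mod_cast hij
    linarith
  linarith

/-- **chord law, upper half**: `C j − C i < Θ j·(S j − S i)` for `i < j ≤ n` (with slack `j − i`). [folklore] -/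
theorem chord_add_le {i j : ℕ} (hij : i < j) (hj : j ≤ n) : C j - C i + ((j : ℤ) - i) ≤ Θ j * (S j - S i) := by
  induction j, hij using Nat.le_induction with
  | base =>
      have h1 := (hsw i (by omega)).2
      push_cast
      linarith
  | succ j hij ih =>
      have h1 := ih (by omega)
      have h2 := (hsw j (by omega)).2
      have h3 : Θ j ≤ Θ (j + 1) := (hΘ j (by omega)).le
      have h4 : S i < S j := by
        have := abscissa_add_le hΘ hsw (i := i) (j := j) (by omega) (by omega)
        have hc : (0 : ℤ) < (j : ℤ) - i := by
          have : (i : ℤ) < j := by exact_mod_cast hij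
          linarith
        linarith
      have h5 : Θ j * (S j - S i) ≤ Θ (j + 1) * (S j - S i) := mul_le_mul_of_nonneg_right h3 (by linarith)
      push_cast at h1 ⊢
      nlinarith

/-- **chord law, upper half**: `C j − C i < Θ j·(S j − S i)` for `i < j ≤ n`. [folklore] -/
theorem chord_lt {i j : ℕ} (hij : i < j) (hj : j ≤ n) : C j - C i < Θ j * (S j - S i) := by
  have h := chord_add_le hΘ hsw hij hj
  have : (0 : ℤ) < (j : ℤ) - i := by
    have : (i : ℤ) < j := by exact_mod_cast hij
    linarith
  linarith

/-- **CHORD-SLACK LAW, lower half**: `2·(C j − C i) ≥ 2·Θ i·(S j − S i) + (j − i)(j − i + 1)` — each of the `j − i` steps of the chord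
clears the supporting line of slope `Θ i` at the left end by one more unit than the previous one. [this seat] -/
theorem chord_slack_lower {i j : ℕ} (hij : i ≤ j) (hj : j ≤ n) :
    2 * Θ i * (S j - S i) + ((j : ℤ) - i) * ((j : ℤ) - i + 1) ≤ 2 * (C j - C i) := by
  induction j, hij using Nat.le_induction with
  | base => simp
  | succ j hij ih =>
      have h1 := ih (by omega)
      have h2 := (hsw j (by omega)).1
      -- `ΔC_j ≥ Θ j ΔS_j + 1 ≥ (Θ i + (j - i)) ΔS_j + 1 ≥ Θ i ΔS_j + (j - i) + 1`
      have h3 := theta_add_le hΘ hij (by omega)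
      have h4 := NewtonPolygon.step_pos hΘ hsw (i := j) (by omega)
      have h5 : (Θ i + ((j : ℤ) - i)) * (S (j + 1) - S j) ≤ Θ j * (S (j + 1) - S j) :=
        mul_le_mul_of_nonneg_right h3 (by linarith)
      have h6 : ((j : ℤ) - i) * 1 ≤ ((j : ℤ) - i) * (S (j + 1) - S j) :=
        mul_le_mul_of_nonneg_left (by linarith) (by
          have : (i : ℤ) ≤ j := by exact_mod_cast hij
          linarith)
      push_cast at h1 ⊢
      nlinarith

/-- **CHORD-SLACK LAW, upper half**: `2·(C j − C i) ≤ 2·Θ j·(S j − S i) − (j − i)(j − i + 1)`. [this seat] -/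
theorem chord_slack_upper {i j : ℕ} (hij : i ≤ j) (hj : j ≤ n) :
    2 * (C j - C i) ≤ 2 * Θ j * (S j - S i) - ((j : ℤ) - i) * ((j : ℤ) - i + 1) := by
  induction j, hij using Nat.le_induction with
  | base => simp
  | succ j hij ih =>
      have h1 := ih (by omega)
      have h2 := (hsw j (by omega)).2
      -- `ΔC_j ≤ Θ (j+1) ΔS_j − 1`, and `Θ j (S j − S i) ≤ (Θ (j+1) − 1)(S j − S i) = Θ (j+1)(S j − S i) − (S j − S i)`
      have h3 := hΘ j (by omega)
      have h4 := abscissa_add_le hΘ hsw hij (by omega)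
      have h5 : (i : ℤ) ≤ j := by exact_mod_cast hij
      have h6 : Θ j * (S j - S i) ≤ (Θ (j + 1) - 1) * (S j - S i) :=
        mul_le_mul_of_nonneg_right (by linarith) (by linarith)
      push_cast at h1 ⊢
      nlinarith

/-! ## §2 Squares: secant monotonicity with slack, the interaction law -/

/-- **SQUARE LAW** (cross-multiplied secant monotonicity with integer slack): for `a < b ≤ c < e ≤ n`, with `W₁ = S b − S a`,
`W₂ = S e − S c`: `(C e − C c)·W₁ − (C b − C a)·W₂ ≥ W₁·W₂·(Θ c − Θ b) + W₁ + W₂`. [this seat] -/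
theorem square_law {a b c e : ℕ} (hab : a < b) (hbc : b ≤ c) (hce : c < e) (he : e ≤ n) :
    (S b - S a) * (S e - S c) * (Θ c - Θ b) + (S b - S a) + (S e - S c) ≤
      (C e - C c) * (S b - S a) - (C b - C a) * (S e - S c) := by
  have h1 : C b - C a + 1 ≤ Θ b * (S b - S a) := chord_lt hΘ hsw hab (by omega)
  have h2 : Θ c * (S e - S c) + 1 ≤ C e - C c := lt_chord hΘ hsw hce he
  have hW₁ : 1 ≤ S b - S a := by
    have := abscissa_add_le hΘ hsw hab.le (by omega)
    have : (a : ℤ) + 1 ≤ b := by exact_mod_cast hab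
    linarith
  have hW₂ : 1 ≤ S e - S c := by
    have := abscissa_add_le hΘ hsw hce.le he
    have : (c : ℤ) + 1 ≤ e := by exact_mod_cast hce
    linarith
  have h3 : (C b - C a + 1) * (S e - S c) ≤ Θ b * (S b - S a) * (S e - S c) :=
    mul_le_mul_of_nonneg_right h1 (by linarith)
  have h4 : (Θ c * (S e - S c) + 1) * (S b - S a) ≤ (C e - C c) * (S b - S a) :=
    mul_le_mul_of_nonneg_right h2 (by linarith)
  nlinarith

/-- **PAIR-INTERACTION LAW** (equal widths): for `a < b ≤ c < e ≤ n` with `S b − S a = S e − S c = W`: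
`(C e − C c) − (C b − C a) ≥ W·(Θ c − Θ b) + 2`. [this seat] -/
theorem interaction_law {a b c e : ℕ} (hab : a < b) (hbc : b ≤ c) (hce : c < e) (he : e ≤ n)
    (hW : S b - S a = S e - S c) :
    (S b - S a) * (Θ c - Θ b) + 2 ≤ (C e - C c) - (C b - C a) := by
  have h1 : C b - C a + 1 ≤ Θ b * (S b - S a) := chord_lt hΘ hsw hab (by omega)
  have h2 : Θ c * (S e - S c) + 1 ≤ C e - C c := lt_chord hΘ hsw hce he
  rw [← hW] at h2
  nlinarith

/-- the interaction is at least `2`: `Θ c ≥ Θ b` and `W ≥ 1`. [this seat] -/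
theorem two_le_interaction {a b c e : ℕ} (hab : a < b) (hbc : b ≤ c) (hce : c < e) (he : e ≤ n)
    (hW : S b - S a = S e - S c) : 2 ≤ (C e - C c) - (C b - C a) := by
  have h := interaction_law hΘ hsw hab hbc hce he hW
  have hθ : Θ b ≤ Θ c := NewtonPolygon.mono_of_succ_lt hΘ hbc (by omega)
  have hW₁ : 1 ≤ S b - S a := by
    have := abscissa_add_le hΘ hsw hab.le (by omega)
    have : (a : ℤ) + 1 ≤ b := by exact_mod_cast hab
    linarith
  nlinarith

/-- **no modular squares**: on an equal-width square `a < b ≤ c < e` the ordinates are never modular, `C a + C e ≠ C b + C c`.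
[this seat] -/
theorem not_modular_square {a b c e : ℕ} (hab : a < b) (hbc : b ≤ c) (hce : c < e) (he : e ≤ n)
    (hW : S b - S a = S e - S c) : C a + C e ≠ C b + C c := by
  intro h
  have := two_le_interaction hΘ hsw hab hbc hce he hW
  linarith

/-! ## §3 Shifted windows (odometer form) and unit-step chains -/

/-- **WINDOW INTERACTION** (odometer form): if the `A` steps after `a` and the `A` steps after `a + B` (`1 ≤ B`, `a + B + A ≤ n`) have the
same abscissa increments, then `(C (a+B+A) − C (a+B)) − (C (a+A) − C a) ≥ 2·A + (B − 1)·(S (a+A) − S a)`. [this seat] -/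
theorem window_interaction (a A B : ℕ) (hB : 1 ≤ B) (hn : a + B + A ≤ n)
    (hshift : ∀ k, k < A → S (a + B + k + 1) - S (a + B + k) = S (a + k + 1) - S (a + k)) :
    2 * (A : ℤ) + ((B : ℤ) - 1) * (S (a + A) - S a) ≤ (C (a + B + A) - C (a + B)) - (C (a + A) - C a) := by
  induction A with
  | zero => simp
  | succ A ih =>
      have h1 := ih (by omega) (fun k hk => hshift k (by omega))
      -- the last pair of steps: indices `a + A < a + A + 1 ≤ a + B + A < a + B + A + 1`
      have hs := hshift A (by omega)
      have h2 := interaction_law hΘ hsw (a := a + A) (b := a + A + 1) (c := a + B + A) (e := a + B + A + 1)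
        (by omega) (by omega) (by omega) (by omega) hs.symm
      have h3 := theta_add_le hΘ (i := a + A + 1) (j := a + B + A) (by omega) (by omega)
      have h4 := NewtonPolygon.step_pos hΘ hsw (i := a + A) (by omega)
      have h5 : ((B : ℤ) - 1) * (S (a + A + 1) - S (a + A)) ≤ (Θ (a + B + A) - Θ (a + A + 1)) * (S (a + A + 1) - S (a + A)) :=
        mul_le_mul_of_nonneg_right (by push_cast at h3 ⊢; linarith) (by linarith)
      have e1 : a + B + (A + 1) = a + B + A + 1 := by ring
      have e2 : a + (A + 1) = a + A + 1 := by ring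
      rw [e1, e2]
      push_cast
      nlinarith

omit hΘ in
/-- on a UNIT-STEP chain (`ΔSᵢ = 1`) consecutive slopes differ by at least `2`. [this seat] -/
theorem unit_theta_step (hunit : ∀ i, i < n → S (i + 1) - S i = 1) {i : ℕ} (hi : i < n) : Θ i + 2 ≤ Θ (i + 1) := by
  have h := step_area hsw hi
  rw [hunit i hi] at h
  linarith

omit hΘ in
/-- on a unit-step chain consecutive ordinate INCREMENTS differ by at least `2` (they interlace with the slopes:
`ΔC_{i} < Θ (i+1) < ΔC_{i+1}`). [this seat] -/
theorem unit_increment_step (hunit : ∀ i, i < n → S (i + 1) - S i = 1) {i : ℕ} (hi : i + 1 < n) :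
    (C (i + 1) - C i) + 2 ≤ C (i + 2) - C (i + 1) := by
  have h1 := (hsw i (by omega)).2
  have h2 := (hsw (i + 1) hi).1
  rw [hunit i (by omega)] at h1
  rw [hunit (i + 1) hi] at h2
  have e : i + 1 + 1 = i + 2 := by ring
  rw [e] at h2
  linarith

omit hΘ in
/-- **UNIT-STEP WINDOW INTERACTION**: on a unit-step chain, `(C (a+B+A) − C (a+B)) − (C (a+A) − C a) ≥ 2·A·B` whenever `a + B + A ≤ n`
(for the binary counter with `d_l = 2^l`: the valuation interaction of bits `u < v` is `≥ 2^(u+v+1)` in every context). [this seat] -/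
theorem unit_window_interaction (hunit : ∀ i, i < n → S (i + 1) - S i = 1) (a A B : ℕ) (hn : a + B + A ≤ n) :
    2 * (A : ℤ) * B ≤ (C (a + B + A) - C (a + B)) - (C (a + A) - C a) := by
  rcases Nat.eq_zero_or_pos B with hB0 | hBpos
  · subst hB0
    simp
  induction A with
  | zero => simp
  | succ A ih =>
      have h1 := ih (by omega)
      -- compare the steps `a + A → a + A + 1` and `a + B + A → a + B + A + 1`
      have hlo := (hsw (a + A) (by omega)).2
      have hhi := (hsw (a + B + A) (by omega)).1
      rw [hunit (a + A) (by omega)] at hlo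
      rw [hunit (a + B + A) (by omega)] at hhi
      -- slopes advance by `≥ 2` per step on a unit-step chain: `Θ (a + A + 1) + 2 (B - 1) ≤ Θ (a + B + A)`
      have key : ∀ t : ℕ, a + A + 1 + t ≤ n → Θ (a + A + 1) + 2 * (t : ℤ) ≤ Θ (a + A + 1 + t) := by
        intro t
        induction t with
        | zero => intro _; simp
        | succ t iht =>
            intro ht
            have := iht (by omega)
            have hst := unit_theta_step hsw hunit (i := a + A + 1 + t) (by omega)
            have e : a + A + 1 + (t + 1) = a + A + 1 + t + 1 := by ring
            rw [e]
            push_cast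
            linarith
      have hθ := key (B - 1) (by omega)
      have e : a + A + 1 + (B - 1) = a + B + A := by omega
      rw [e] at hθ
      push_cast [Nat.cast_sub hBpos] at hθ
      have e1 : a + B + (A + 1) = a + B + A + 1 := by ring
      have e2 : a + (A + 1) = a + A + 1 := by ring
      rw [e1, e2]
      push_cast
      nlinarith

end Lattice

/-! ## §4 Dominant chains of a design -/

namespace Design

variable {m K : ℕ} (d : Fin K → ℕ) (v ε : Fin m → Fin m → Fin K → ℤ)
  {n : ℕ} {Θ : ℕ → ℤ} {P : ℕ → Equiv.Perm (Fin m) × (Fin m → Fin K)}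
  (hΘ : ∀ i, i < n → Θ i < Θ (i + 1)) (hdom : ∀ i, i ≤ n → IsDominant d v ε (Θ i) (P i)) (hne : ∀ i, i < n → P i ≠ P (i + 1))
include hΘ hdom hne

omit hΘ in
/-- the sandwich of a dominant chain, in the shape used by §1–§3 (`NewtonPolygon.sandwich`). [folklore] -/
theorem sandwich' : ∀ i, i < n →
    Θ i * (IntervalOpt.sl d univ (P (i + 1)) - IntervalOpt.sl d univ (P i)) <
        IntervalOpt.cst v univ (P (i + 1)) - IntervalOpt.cst v univ (P i) ∧
      IntervalOpt.cst v univ (P (i + 1)) - IntervalOpt.cst v univ (P i) <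
        Θ (i + 1) * (IntervalOpt.sl d univ (P (i + 1)) - IntervalOpt.sl d univ (P i)) :=
  fun _ hi => NewtonPolygon.sandwich d v ε hdom hne hi

/-- **CHORD-SLACK LAW for dominant chains** (lower half): the valuation sum clears the supporting line of slope `Θ i` through term `i`
by a triangular number: `2(V j − V i) ≥ 2·Θ i·(s j − s i) + (j − i)(j − i + 1)`. [this seat] -/
theorem chord_slack_lower {i j : ℕ} (hij : i ≤ j) (hj : j ≤ n) :
    2 * Θ i * (IntervalOpt.sl d univ (P j) - IntervalOpt.sl d univ (P i)) + ((j : ℤ) - i) * ((j : ℤ) - i + 1) ≤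
      2 * (IntervalOpt.cst v univ (P j) - IntervalOpt.cst v univ (P i)) :=
  ChordSlack.chord_slack_lower (S := fun i => IntervalOpt.sl d univ (P i)) (C := fun i => IntervalOpt.cst v univ (P i))
    hΘ (sandwich' d v ε hdom hne) hij hj

/-- **CHORD-SLACK LAW for dominant chains** (upper half): `2(V j − V i) ≤ 2·Θ j·(s j − s i) − (j − i)(j − i + 1)`. [this seat] -/
theorem chord_slack_upper {i j : ℕ} (hij : i ≤ j) (hj : j ≤ n) :
    2 * (IntervalOpt.cst v univ (P j) - IntervalOpt.cst v univ (P i)) ≤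
      2 * Θ j * (IntervalOpt.sl d univ (P j) - IntervalOpt.sl d univ (P i)) - ((j : ℤ) - i) * ((j : ℤ) - i + 1) :=
  ChordSlack.chord_slack_upper (S := fun i => IntervalOpt.sl d univ (P i)) (C := fun i => IntervalOpt.cst v univ (P i))
    hΘ (sandwich' d v ε hdom hne) hij hj

/-- **PAIR-INTERACTION LAW for dominant chains**: four terms `a < b ≤ c < e` of the chain with `s b − s a = s e − s c = W` have
`(V e − V c) − (V b − V a) ≥ W·(Θ c − Θ b) + 2` — the later copy of the same exponent increment costs strictly more valuation, by at least
`2` plus `W` per unit of slope elapsed between the two copies. [this seat] -/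
theorem interaction_law {a b c e : ℕ} (hab : a < b) (hbc : b ≤ c) (hce : c < e) (he : e ≤ n)
    (hW : IntervalOpt.sl d univ (P b) - IntervalOpt.sl d univ (P a) = IntervalOpt.sl d univ (P e) - IntervalOpt.sl d univ (P c)) :
    (IntervalOpt.sl d univ (P b) - IntervalOpt.sl d univ (P a)) * (Θ c - Θ b) + 2 ≤
      (IntervalOpt.cst v univ (P e) - IntervalOpt.cst v univ (P c)) - (IntervalOpt.cst v univ (P b) - IntervalOpt.cst v univ (P a)) :=
  ChordSlack.interaction_law (S := fun i => IntervalOpt.sl d univ (P i)) (C := fun i => IntervalOpt.cst v univ (P i))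
    hΘ (sandwich' d v ε hdom hne) hab hbc hce he hW

/-- **no valuation-modular squares in a dominant chain**: with `a < b ≤ c < e` and equal exponent increments,
`V a + V e ≠ V b + V c` — in particular the incidences of the four terms are not modular ((row, column, class) counts of `{P a, P e}` and
`{P b, P c}` cannot agree), since equal counts give equal valuation sums. [this seat] -/
theorem not_valModular_square {a b c e : ℕ} (hab : a < b) (hbc : b ≤ c) (hce : c < e) (he : e ≤ n)
    (hW : IntervalOpt.sl d univ (P b) - IntervalOpt.sl d univ (P a) = IntervalOpt.sl d univ (P e) - IntervalOpt.sl d univ (P c)) :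
    IntervalOpt.cst v univ (P a) + IntervalOpt.cst v univ (P e) ≠ IntervalOpt.cst v univ (P b) + IntervalOpt.cst v univ (P c) :=
  ChordSlack.not_modular_square (S := fun i => IntervalOpt.sl d univ (P i)) (C := fun i => IntervalOpt.cst v univ (P i))
    hΘ (sandwich' d v ε hdom hne) hab hbc hce he hW

/-- **WINDOW INTERACTION for dominant chains** (odometers): if the `A` steps after term `a` and the `A` steps after term `a + B` change the
total exponent by the same amounts step by step (`1 ≤ B`, `a + B + A ≤ n`), then
`(V (a+B+A) − V (a+B)) − (V (a+A) − V a) ≥ 2·A + (B − 1)·(s (a+A) − s a)`. [this seat] -/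
theorem window_interaction (a A B : ℕ) (hB : 1 ≤ B) (hn : a + B + A ≤ n)
    (hshift : ∀ k, k < A → IntervalOpt.sl d univ (P (a + B + k + 1)) - IntervalOpt.sl d univ (P (a + B + k)) =
      IntervalOpt.sl d univ (P (a + k + 1)) - IntervalOpt.sl d univ (P (a + k))) :
    2 * (A : ℤ) + ((B : ℤ) - 1) * (IntervalOpt.sl d univ (P (a + A)) - IntervalOpt.sl d univ (P a)) ≤
      (IntervalOpt.cst v univ (P (a + B + A)) - IntervalOpt.cst v univ (P (a + B))) -
        (IntervalOpt.cst v univ (P (a + A)) - IntervalOpt.cst v univ (P a)) :=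
  ChordSlack.window_interaction (S := fun i => IntervalOpt.sl d univ (P i)) (C := fun i => IntervalOpt.cst v univ (P i))
    hΘ (sandwich' d v ε hdom hne) a A B hB hn hshift

omit hΘ in
/-- **UNIT-STEP WINDOW INTERACTION for dominant chains**: if every step raises the total exponent by exactly `1` (binary counters on
`d_l = 2^l`, and every chain on exponents `{0, 1, …}` counting through consecutive slopes), then
`(V (a+B+A) − V (a+B)) − (V (a+A) − V a) ≥ 2·A·B`. [this seat] -/
theorem unit_window_interaction (hunit : ∀ i, i < n → IntervalOpt.sl d univ (P (i + 1)) - IntervalOpt.sl d univ (P i) = 1)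
    (a A B : ℕ) (hn : a + B + A ≤ n) :
    2 * (A : ℤ) * B ≤ (IntervalOpt.cst v univ (P (a + B + A)) - IntervalOpt.cst v univ (P (a + B))) -
      (IntervalOpt.cst v univ (P (a + A)) - IntervalOpt.cst v univ (P a)) :=
  ChordSlack.unit_window_interaction (S := fun i => IntervalOpt.sl d univ (P i)) (C := fun i => IntervalOpt.cst v univ (P i))
    (sandwich' d v ε hdom hne) hunit a A B hn

end Design

end ChordSlack

end Summit.ValiantsHypothesis.ValiantsHypothesis.Theorems.KPlusLogSqLaw
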